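import Summits.BirchSwinnertonDyer.BirchSwinnertonDyer.Theorems.GenusKolyvaginAtTwoTorsionCellSELNegTwistKernel
import HarnessLib

/-!
# SEL (iso-class Selmer pair law), C1-F: the raw row system of a Selmer class of the negative twist `E^{(−p₀M)}`

Crux R″ `RankOneTwoTorsionResidualAtTwo` (stmt-27478), LINE 49 «full_vertex», SUPPORT stub SEL
`IsoClassSelmerPairLawAtTwo`, the `C₁` half (LEAD memo `Cruxes/…/Lines/torsion_cell_full_vertex_SEL_C1_road_g36.md`,
§1 and §3).  Setting of part C1-E with the labelling `e₁ < e₂ < e₃`, `Q` of even size, full-admissible (`δ₁, δ₂`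
non-residues at every `q ∈ Q`), the common bit `ε = qr_q(e₂ − e₁)`, and the residues at `p₀` of the root data
(`qr_{p₀}(e₂−e₁) = 0`, `qr_{p₀}(δ₁) = 0`, `qr_{p₀}(δ₂) = 1`, `qr_{p₀}(e₁−e₂) = 1` — every positive `S`-unit is a square
mod `p₀`; taken as hypotheses here).

**`rows_of_mem_selmerGroup_negTwist`** — for `c ∈ Sel⁽²⁾(E^{(d)}/ℚ)`, `d = −p₀∏_{q∈Q} q`, with components `[a], [b]`,
kernels `m_a, m_b` and `p₀`-parities `γ_a, γ_b` (part C1-E), the `I₀*` relations at the primes of `Q` and at `p₀` and the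
sign condition at `∞` read, in the symbols of `Q` (`G j i = [−i/j]`, `g_j = Σ_{i≠j} G j i`, `π_j = [−p₀/j]`, `p_a, p_b` the
`Q`-parity vectors):
  (Qa) `Σ_{i≠j} G j i p_a(i) + (g_j + π_j + ε) p_a(j) + p_b(j) = qr_j(m_a) + γ_a π_j + |p_a|`,
  (Qb) `Σ_{i≠j} G j i p_b(i) + (g_j + π_j + ε + 1) p_b(j) + p_a(j) = qr_j(m_b) + γ_b π_j + |p_b|`,
  (Pa) `qr_{p₀}(m_a) + Σ_i π_i p_a(i) + γ_a|π| = 0`,  (Pb) `qr_{p₀}(m_b) + γ_b + Σ_i π_i p_b(i) + γ_a + γ_b|π| = 0`,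
  (∞)  `sgn m_a + γ_a = sgn m_b + γ_b`
— the raw form of the unified system `SysC1` of part C1-C (whose scalars `τ₁, τ₂, σ` parametrise the admissible values of
`qr(m), sgn(m)`, parts C1-G/H).  Everything is proved; no LINE 49 statement is restated; BSD is not advanced by this file
alone.

## References

* [SilvermanAEC2009] J. H. Silverman, *The Arithmetic of Elliptic Curves*, 2nd ed., Prop. X.1.4, Prop. X.4.9.
* [MazurRubin2010] B. Mazur, K. Rubin, Invent. Math. 181 (2010), Lemma 2.10, Lemma 2.11.
* [Kane2013SelmerTwists] D. M. Kane, Algebra Number Theory 7 (2013), §2.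
-/

noncomputable section

open scoped Classical

namespace Summit.BirchSwinnertonDyer.BirchSwinnertonDyer.Theorems.GenusKolyvaginAtTwo.TorsionCellSEL

open WeierstrassCurve WeierstrassCurve.Affine WeierstrassCurve.Affine.Point
open Literature.NumberTheory.GaloisRepresentations Literature.NumberTheory.EllipticCurves Field
open Literature.NumberTheory.EllipticCurves.TwoDescentLocal
open Literature.NumberTheory.EllipticCurves.KramerTwoDescent
open Summit.BirchSwinnertonDyer.BirchSwinnertonDyer.Theorems.GenusKolyvaginAtTwo.TorsionCellD0
open IsDedekindDomain NumberField Rat.HeightOneSpectrum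

variable (E : WeierstrassCurve ℚ) [E.IsElliptic] {e₁ e₂ e₃ : ℚ} (S Q : Finset ℕ)

/-- `#(Q∖j) = 1` in `𝔽₂` for `#Q` even and `j ∈ Q`. [folklore] -/
private theorem card_erase_cast_eq_one' {Q : Finset ℕ} (hk : Even Q.card) {j : ℕ} (hj : j ∈ Q) :
    ((Q.erase j).card : ZMod 2) = 1 := by
  rw [Finset.card_erase_of_mem hj]
  obtain ⟨r, hr⟩ := hk
  have hpos : 0 < Q.card := Finset.card_pos.mpr ⟨j, hj⟩
  have : Q.card - 1 = 2 * (r - 1) + 1 := by omega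
  rw [this, Nat.cast_add, Nat.cast_mul, show ((2 : ℕ) : ZMod 2) = 0 by decide, zero_mul, zero_add, Nat.cast_one]

/-- **THE RAW ROW SYSTEM of a Selmer class of the negative twist `E^{(−p₀M)}`** (the `I₀*` relations at `Q ∪ {p₀}`
and the sign condition at `∞`, in the symbols of `Q`; see the module docstring for the five relations).
[cite: SilvermanAEC2009, Prop. X.1.4, Prop. X.4.9] [cite: MazurRubin2010, Lemma 2.10, Lemma 2.11]
[cite: Kane2013SelmerTwists, §2] -/
theorem rows_of_mem_selmerGroup_negTwist (h : E.toAffine.SplitTwoTorsion e₁ e₂ e₃) (h12 : e₁ < e₂) (h23 : e₂ < e₃)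
    (hS : ∀ ℓ ∈ S, ℓ.Prime)
    (hgood : ∀ ℓ : ℕ, (hℓ : ℓ.Prime) → ℓ ∉ S → haveI : Fact ℓ.Prime := ⟨hℓ⟩;
      padicValRat ℓ (e₁ - e₂) = 0 ∧ padicValRat ℓ (e₁ - e₃) = 0 ∧ padicValRat ℓ (e₂ - e₃) = 0)
    (hQ : ∀ q ∈ Q, q.Prime) (hQS : ∀ q ∈ Q, q ∉ S) (hQ4 : ∀ q ∈ Q, q % 4 = 3) (hk : Even Q.card)
    (hiso8 : ∀ q ∈ Q, ∀ q' ∈ Q, q % 8 = q' % 8)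
    (hisoS : ∀ q ∈ Q, ∀ q' ∈ Q, ∀ ℓ ∈ S, (hℓ : ℓ.Prime) → ℓ ≠ 2 → haveI : Fact ℓ.Prime := ⟨hℓ⟩;
      legendreSym ℓ ((q : ℤ) * q') = 1)
    (hadm : ∀ q ∈ Q, (hq : q.Prime) → haveI : Fact q.Prime := ⟨hq⟩;
      qrBit q ((e₁ - e₂) * (e₁ - e₃)) = 1 ∧ qrBit q ((e₂ - e₁) * (e₂ - e₃)) = 1)
    {ε : ZMod 2} (hε : ∀ q ∈ Q, (hq : q.Prime) → haveI : Fact q.Prime := ⟨hq⟩; qrBit q (e₂ - e₁) = ε)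
    {p₀ : ℕ} [hp₀ : Fact p₀.Prime] (hp₀S : p₀ ∉ S) (hp₀Q : p₀ ∉ Q) (hp₀4 : p₀ % 4 = 3)
    (hres₀ : qrBit p₀ (e₂ - e₁) = 0 ∧ qrBit p₀ (e₁ - e₂) = 1 ∧
      qrBit p₀ ((e₁ - e₂) * (e₁ - e₃)) = 0 ∧ qrBit p₀ ((e₂ - e₁) * (e₂ - e₃)) = 1)
    {d : ℚ} (hd : d = -(p₀ : ℚ) * ∏ q ∈ Q, (q : ℚ)) [(E.quadraticTwist d).IsElliptic]
    {c : galH1Torsion (E.quadraticTwist d) 2} (hc : c ∈ selmerGroup (E.quadraticTwist d) 2) (a b : ℚˣ)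
    (ha : kummerEquiv ℚ 2 ((E.quadraticTwist d).twoTorsionCharH1 (h.quadraticTwist d) c) =
      Additive.ofMul (QuotientGroup.mk a))
    (hb : kummerEquiv ℚ 2 ((E.quadraticTwist d).twoTorsionCharH1 (h.quadraticTwist d).swap₁₂ c) =
      Additive.ofMul (QuotientGroup.mk b)) :
    ∃ (ma mb : ℤ) (γa γb : ZMod 2),
      ((ma : ℚ) ≠ 0 ∧ (∀ ℓ : ℕ, ℓ.Prime → ℓ ∉ S → ¬ (ℓ : ℤ) ∣ ma) ∧ parityBit p₀ (a : ℚ) = γa ∧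
        (∃ hg : (ma : ℚ) * (if γa = 1 then -(p₀ : ℚ) else 1) * ∏ i ∈ Q.filter (fun i => parityBit i (a : ℚ) = 1), (i : ℚ) ≠ 0,
          (QuotientGroup.mk a : SqUnits ℚ) = QuotientGroup.mk (Units.mk0 _ hg)) ∧
        (∀ q ∈ Q, ∀ q' ∈ Q, (hq : q.Prime) → (hq' : q'.Prime) →
          haveI : Fact q.Prime := ⟨hq⟩; haveI : Fact q'.Prime := ⟨hq'⟩; qrBit q (ma : ℚ) = qrBit q' (ma : ℚ))) ∧
      ((mb : ℚ) ≠ 0 ∧ (∀ ℓ : ℕ, ℓ.Prime → ℓ ∉ S → ¬ (ℓ : ℤ) ∣ mb) ∧ parityBit p₀ (b : ℚ) = γb ∧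
        (∃ hg : (mb : ℚ) * (if γb = 1 then -(p₀ : ℚ) else 1) * ∏ i ∈ Q.filter (fun i => parityBit i (b : ℚ) = 1), (i : ℚ) ≠ 0,
          (QuotientGroup.mk b : SqUnits ℚ) = QuotientGroup.mk (Units.mk0 _ hg)) ∧
        (∀ q ∈ Q, ∀ q' ∈ Q, (hq : q.Prime) → (hq' : q'.Prime) →
          haveI : Fact q.Prime := ⟨hq⟩; haveI : Fact q'.Prime := ⟨hq'⟩; qrBit q (mb : ℚ) = qrBit q' (mb : ℚ))) ∧
      (∀ j ∈ Q, (hj : j.Prime) → haveI : Fact j.Prime := ⟨hj⟩;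
        ((∑ i ∈ Q.erase j, (if jacobiSym (-(i : ℤ)) j = -1 then (1 : ZMod 2) else 0) * parityBit i (a : ℚ)) +
            ((∑ i ∈ Q.erase j, (if jacobiSym (-(i : ℤ)) j = -1 then (1 : ZMod 2) else 0)) +
              (if jacobiSym (-(p₀ : ℤ)) j = -1 then (1 : ZMod 2) else 0) + ε) * parityBit j (a : ℚ) +
            parityBit j (b : ℚ) =
          qrBit j (ma : ℚ) + γa * (if jacobiSym (-(p₀ : ℤ)) j = -1 then (1 : ZMod 2) else 0) +
            ∑ i ∈ Q, parityBit i (a : ℚ)) ∧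
        ((∑ i ∈ Q.erase j, (if jacobiSym (-(i : ℤ)) j = -1 then (1 : ZMod 2) else 0) * parityBit i (b : ℚ)) +
            ((∑ i ∈ Q.erase j, (if jacobiSym (-(i : ℤ)) j = -1 then (1 : ZMod 2) else 0)) +
              (if jacobiSym (-(p₀ : ℤ)) j = -1 then (1 : ZMod 2) else 0) + ε + 1) * parityBit j (b : ℚ) +
            parityBit j (a : ℚ) =
          qrBit j (mb : ℚ) + γb * (if jacobiSym (-(p₀ : ℤ)) j = -1 then (1 : ZMod 2) else 0) +
            ∑ i ∈ Q, parityBit i (b : ℚ))) ∧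
      (qrBit p₀ (ma : ℚ) + ∑ i ∈ Q, (if jacobiSym (-(p₀ : ℤ)) i = -1 then (1 : ZMod 2) else 0) * parityBit i (a : ℚ) +
          γa * ∑ i ∈ Q, (if jacobiSym (-(p₀ : ℤ)) i = -1 then (1 : ZMod 2) else 0) = 0) ∧
      (qrBit p₀ (mb : ℚ) + γb + ∑ i ∈ Q, (if jacobiSym (-(p₀ : ℤ)) i = -1 then (1 : ZMod 2) else 0) * parityBit i (b : ℚ) +
          γa + γb * ∑ i ∈ Q, (if jacobiSym (-(p₀ : ℤ)) i = -1 then (1 : ZMod 2) else 0) = 0) ∧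
      (signBit (ma : ℚ) + γa = signBit (mb : ℚ) + γb) := by
  -- kernels of the two components
  obtain ⟨ma, γa, hma0, hmadiv, hγa, hcla, hηa, hsa, hrowa, hp₀a⟩ :=
    exists_intKernel_of_mem_selmerGroup_negTwist E S Q h hS
      (fun ℓ hℓ hℓS => ⟨(hgood ℓ hℓ hℓS).1, (hgood ℓ hℓ hℓS).2.1⟩) hQ hQS hQ4 hiso8 hisoS hp₀S hp₀Q hp₀4 hd hc a ha
  obtain ⟨mb, γb, hmb0, hmbdiv, hγb, hclb, hηb, hsb, hrowb, hp₀b⟩ :=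
    exists_intKernel_of_mem_selmerGroup_negTwist E S Q h.swap₁₂ hS
      (fun ℓ hℓ hℓS => ⟨by rw [← neg_sub, padicValRat.neg]; exact (hgood ℓ hℓ hℓS).1, (hgood ℓ hℓ hℓS).2.2⟩)
      hQ hQS hQ4 hiso8 hisoS hp₀S hp₀Q hp₀4 hd hc b hb
  refine ⟨ma, mb, γa, γb, ⟨hma0, hmadiv, hγa, hcla, hηa⟩, ⟨hmb0, hmbdiv, hγb, hclb, hηb⟩, ?_, ?_, ?_, ?_⟩
  · -- the rows at `j ∈ Q`
    intro j hj hjp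
    haveI : Fact j.Prime := ⟨hjp⟩
    subst hd
    have hjS : j ∉ S := hQS j hj
    have hjp₀ : p₀ ≠ j := fun e => hp₀Q (e ▸ hj)
    obtain ⟨g12, g13, g23⟩ := hgood j hjp hjS
    have hQ0 : ∀ q ∈ Q, (q : ℚ) ≠ 0 := fun q hq => by exact_mod_cast (hQ q hq).ne_zero
    have hP0 : ∏ q ∈ Q, (q : ℚ) ≠ 0 := Finset.prod_ne_zero_iff.mpr hQ0
    have hp0 : (p₀ : ℚ) ≠ 0 := by exact_mod_cast hp₀.out.ne_zero
    have hvd : padicValRat j (-(p₀ : ℚ) * ∏ q ∈ Q, (q : ℚ)) = 1 := by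
      rw [padicValRat.mul (neg_ne_zero.mpr hp0) hP0, padicValRat.neg, padicValRat_prod_primes hQ j, if_pos hj,
        show (p₀ : ℚ) = ((p₀ : ℕ) : ℚ) from rfl, padicValRat.of_nat, padicValNat_primes hjp₀.symm]
      rfl
    obtain ⟨r1, r2⟩ := E.qrBit_rel_quadraticTwist_of_mem_selmerGroup h hvd g12 g13 g23 hc a b ha hb
    obtain ⟨hδ₁, hδ₂⟩ := hadm j hj hjp
    have hεj := hε j hj hjp
    have he21 : e₂ - e₁ ≠ 0 := sub_ne_zero.mpr h.ne₁₂.symm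
    have hε' : qrBit j (e₁ - e₂) = 1 + ε := by
      rw [← neg_sub, qrBit_neg (p := j) he21, qrBit_neg_one_eq_one_of_emod_four (hQ4 j hj), hεj]
    have hqd : qrBit j (-(p₀ : ℚ) * ∏ q ∈ Q, (q : ℚ)) = (if jacobiSym (-(p₀ : ℤ)) j = -1 then (1 : ZMod 2) else 0) +
        (1 + ∑ i ∈ Q.erase j, (if jacobiSym (-(i : ℤ)) j = -1 then (1 : ZMod 2) else 0)) := by
      rw [qrBit_mul j (neg_ne_zero.mpr hp0) hP0, qrBit_neg_natCast_prime_eq hp₀.out hjp₀,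
        qrBit_prod_natCast_eq Q hQ (hQ4 j hj) (subset_refl Q), card_erase_cast_eq_one' hk hj]
    rw [hδ₁, hεj, hqd, hrowa j hj hjp] at r1
    rw [hδ₂, hε', hqd, hrowb j hj hjp] at r2
    -- split `Σ_{i≠j} (1 + G j i) p(i) = |p| + p(j) + Σ_{i≠j} G j i p(i)`
    have hsplit : ∀ (x : ℚ), (∑ i ∈ Q.erase j,
        (1 + (if jacobiSym (-(i : ℤ)) j = -1 then (1 : ZMod 2) else 0)) * parityBit i x) =
        (∑ i ∈ Q, parityBit i x) + parityBit j x +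
          ∑ i ∈ Q.erase j, (if jacobiSym (-(i : ℤ)) j = -1 then (1 : ZMod 2) else 0) * parityBit i x := by
      intro x
      simp only [add_mul, one_mul, Finset.sum_add_distrib]
      rw [← Finset.sum_erase_add Q (fun i => parityBit i x) hj, add_assoc (∑ i ∈ Q.erase j, parityBit i x),
        CharTwo.add_self_eq_zero, add_zero]
    rw [hsplit] at r1 r2
    constructor
    · linear_combination (norm := (ring_nf; reduce_mod_char)) r1
    · linear_combination (norm := (ring_nf; reduce_mod_char)) r2
  · -- (Pa) at `p₀`
    subst hd
    have hQ0 : ∀ q ∈ Q, (q : ℚ) ≠ 0 := fun q hq => by exact_mod_cast (hQ q hq).ne_zero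
    have hP0 : ∏ q ∈ Q, (q : ℚ) ≠ 0 := Finset.prod_ne_zero_iff.mpr hQ0
    have hp0 : (p₀ : ℚ) ≠ 0 := by exact_mod_cast hp₀.out.ne_zero
    obtain ⟨g12, g13, g23⟩ := hgood p₀ hp₀.out hp₀S
    have hvd : padicValRat p₀ (-(p₀ : ℚ) * ∏ q ∈ Q, (q : ℚ)) = 1 := by
      rw [padicValRat.mul (neg_ne_zero.mpr hp0) hP0, padicValRat.neg, padicValRat_prod_primes hQ p₀, if_neg hp₀Q,
        show (p₀ : ℚ) = ((p₀ : ℕ) : ℚ) from rfl, padicValRat.of_nat, padicValNat_self]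
      rfl
    obtain ⟨r1, -⟩ := E.qrBit_rel_quadraticTwist_of_mem_selmerGroup h hvd g12 g13 g23 hc a b ha hb
    have hqd : qrBit p₀ (-(p₀ : ℚ) * ∏ q ∈ Q, (q : ℚ)) =
        1 + ∑ i ∈ Q, (if jacobiSym (-(p₀ : ℤ)) i = -1 then (1 : ZMod 2) else 0) := by
      rw [show -(p₀ : ℚ) * ∏ q ∈ Q, (q : ℚ) = (p₀ : ℚ) * (-1 * ∏ q ∈ Q, (q : ℚ)) by ring, qrBit_natCast_mul,
        qrBit_mul p₀ (by norm_num) hP0, qrBit_neg_one_eq_one_of_emod_four hp₀4,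
        qrBit_prod_natCast Q (fun i hi => (hQ i hi).ne_zero)]
      congr 1
      refine Finset.sum_congr rfl fun i hi => ?_
      exact qrBit_natCast_prime_eq_jacobiBit (hQ i hi) (fun e => hp₀Q (e ▸ hi)) hp₀4 (hQ4 i hi)
    rw [hres₀.1, hres₀.2.2.1, hqd, hγa, hγb, hp₀a] at r1
    linear_combination (norm := (ring_nf; reduce_mod_char)) r1
  · -- (Pb) at `p₀`
    subst hd
    have hQ0 : ∀ q ∈ Q, (q : ℚ) ≠ 0 := fun q hq => by exact_mod_cast (hQ q hq).ne_zero
    have hP0 : ∏ q ∈ Q, (q : ℚ) ≠ 0 := Finset.prod_ne_zero_iff.mpr hQ0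
    have hp0 : (p₀ : ℚ) ≠ 0 := by exact_mod_cast hp₀.out.ne_zero
    obtain ⟨g12, g13, g23⟩ := hgood p₀ hp₀.out hp₀S
    have hvd : padicValRat p₀ (-(p₀ : ℚ) * ∏ q ∈ Q, (q : ℚ)) = 1 := by
      rw [padicValRat.mul (neg_ne_zero.mpr hp0) hP0, padicValRat.neg, padicValRat_prod_primes hQ p₀, if_neg hp₀Q,
        show (p₀ : ℚ) = ((p₀ : ℕ) : ℚ) from rfl, padicValRat.of_nat, padicValNat_self]
      rfl
    obtain ⟨-, r2⟩ := E.qrBit_rel_quadraticTwist_of_mem_selmerGroup h hvd g12 g13 g23 hc a b ha hb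
    have hqd : qrBit p₀ (-(p₀ : ℚ) * ∏ q ∈ Q, (q : ℚ)) =
        1 + ∑ i ∈ Q, (if jacobiSym (-(p₀ : ℤ)) i = -1 then (1 : ZMod 2) else 0) := by
      rw [show -(p₀ : ℚ) * ∏ q ∈ Q, (q : ℚ) = (p₀ : ℚ) * (-1 * ∏ q ∈ Q, (q : ℚ)) by ring, qrBit_natCast_mul,
        qrBit_mul p₀ (by norm_num) hP0, qrBit_neg_one_eq_one_of_emod_four hp₀4,
        qrBit_prod_natCast Q (fun i hi => (hQ i hi).ne_zero)]
      congr 1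
      refine Finset.sum_congr rfl fun i hi => ?_
      exact qrBit_natCast_prime_eq_jacobiBit (hQ i hi) (fun e => hp₀Q (e ▸ hi)) hp₀4 (hQ4 i hi)
    rw [hres₀.2.1, hres₀.2.2.2, hqd, hγa, hγb, hp₀b] at r2
    linear_combination (norm := (ring_nf; reduce_mod_char)) r2
  · -- (∞): `sgn a = sgn b`
    have h' := h.quadraticTwist d
    have hPpos : (0 : ℚ) < ∏ q ∈ Q, (q : ℚ) := Finset.prod_pos fun q hq => by exact_mod_cast (hQ q hq).pos
    have hp0 : (0 : ℚ) < p₀ := by exact_mod_cast hp₀.out.pos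
    have hdneg : d < 0 := by rw [hd]; nlinarith
    have hab := (E.quadraticTwist d).mul_pos_of_mem_selmerGroup_of_gt h' (mul_lt_mul_of_neg_left h12 hdneg)
      (mul_lt_mul_of_neg_left h23 hdneg) hc a b ha hb
    have hsab : signBit (a : ℚ) = signBit (b : ℚ) := by
      rcases lt_or_gt_of_ne a.ne_zero with han | hap
      · have hbn : (b : ℚ) < 0 := by
          by_contra hb'
          have := mul_nonpos_of_nonpos_of_nonneg han.le (not_lt.mp hb')
          linarith
        rw [signBit, signBit, if_pos han, if_pos hbn]
      · have hbp : 0 < (b : ℚ) := pos_of_mul_pos_right hab hap.le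
        rw [(signBit_eq_zero_iff a.ne_zero).mpr hap, (signBit_eq_zero_iff b.ne_zero).mpr hbp]
    rw [hsa, hsb] at hsab
    exact hsab

end Summit.BirchSwinnertonDyer.BirchSwinnertonDyer.Theorems.GenusKolyvaginAtTwo.TorsionCellSEL

end
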